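import Literature.Algebra.EuclideanLattices.MRLemma510Law
import Literature.Algebra.EuclideanLattices.MRLemma510StopQuality
import HarnessLib

/-!
# The law of the machine-level Lemma 5.10 loop with the sharp stopping quality `‖S‖ ≤ 8γη + 1`

Topic `Algebra/EuclideanLattices` (family `pqc`). Twin of the conclusion of `MRLemma510Law.lean`
(`toReal_loopOut_bad_le`: after `T` rounds the run of MR07 Lemma 5.10 with a probabilistic `IncGDD` solver has
stopped with good rows of norm `≤ 16 γ η_{2⁻ⁿ}(Λ)`, except with probability `≤ T(1 − p)^{k₀}`) with the
constant of the stopping case sharpened to what the machine-level MR07 **Thm. 5.23** needs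
(`MRLemma510StopQuality.maxNorm_le_of_not_promise_sharp`: `‖S‖ ≤ 8 γ η_{2⁻ⁿ}(Λ) + 1`; authors' version
p. 29: "`‖S‖ ≤ 8β√n η_ε(B*)`", a constant on which the verifier's window depends under the printed modulus
condition). Same chain, same potential argument; only the invariant's stopped clause changes:

* `goodSetSharp`, `toReal_roundKernel'_compl_goodSetSharp_le` — the invariant with the sharp clause is left
  with probability `≤ (1 − p)^{k₀}` per round;
* **`toReal_loopOut_bad_le_sharp`** — after `T` rounds with `(7/8)^T ∏‖uⱼ‖ < 1` the run has STOPPED with good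
  rows of norm `≤ 8 γ η_{2⁻ⁿ}(Λ) + 1`, except with probability `≤ T (1 − p)^{k₀}`.

All proved; one definition with body (`goodSetSharp`); no named fact.

## References

* D. Micciancio, O. Regev, *Worst-case to average-case reductions based on Gaussian measures*,
  SIAM J. Comput. 37 (2007) 267–302; authors' version, Lemma 5.10 and its proof (p. 24), Cor. 5.13 (p. 25),
  Thm. 5.23 (proof, first step, p. 29).
-/

noncomputable section

namespace Literature.Algebra.EuclideanLattices

namespace MRLemma510

open Literature.Computability.Complexity Literature.Computability.Cryptography Literature.Probability.Distributions
  PMF MeasureTheory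
open scoped ENNReal

variable (c : Ctx) (Sol : RandAlg (List Bool) (List Bool)) (K : ℕ)

/-- The good states of the chain with the SHARP stopped clause `‖S‖ ≤ 8 γ η_{2⁻ⁿ}(Λ) + 1`.
[cite: MicciancioRegev2007, Lemma 5.10 (proof: potential argument and the stopping guarantee)] -/
def goodSetSharp (γ : ℝ) : Set (ℕ × (Bool × List (List ℤ))) :=
  {s | GoodRows c s.2.2 ∧
    ((s.2.1 = true ∧ potential c.n s.2.2 ≤ (7 / 8 : ℝ) ^ s.1 * potential c.n c.U) ∨
      (s.2.1 = false ∧ Real.sqrt (roundA s.2.2) ≤ 8 * (γ * smoothingParameter c.lattice ((2⁻¹ : ℝ) ^ c.n)) + 1))}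

/-- **Each round leaves the sharp good states with probability `≤ (1 − p)^{k₀}`** (as
`toReal_roundKernel'_compl_goodSet_le`, with the sharp stopping lemma). [cite: MicciancioRegev2007, Lemma 5.10 (proof) with Cor. 5.13] -/
theorem toReal_roundKernel'_compl_goodSetSharp_le (hc : c.WF) {γ p : ℝ} (hp1 : p ≤ 1)
    (hK : ∀ V, GoodRows c V → Sol.coinLen (roundInst c V).encode.length = K)
    (hsol : ∀ V, GoodRows c V → (roundInst c V).Promise γ →
      p ≤ Sol.pr id (roundInst c V).encode (roundInst c V).goodAnswers)
    (s : ℕ × (Bool × List (List ℤ))) (hs : s ∈ goodSetSharp c γ) :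
    ((roundKernel' c Sol K s).toOuterMeasure (goodSetSharp c γ)ᶜ).toReal ≤ (1 - p) ^ c.k₀ := by
  classical
  obtain ⟨j, run, V⟩ := s
  obtain ⟨hV, hcase⟩ := hs
  dsimp only at hV hcase
  rw [roundKernel', PMF.toOuterMeasure_map_apply]
  rcases hcase with ⟨rfl, hpot⟩ | ⟨rfl, hshort⟩
  · -- running
    by_cases hprom : (roundInst c V).Promise γ
    · -- bad outcomes are stops
      have hsub : (fun b : List.Vector Bool (K * c.k₀) =>
            (j + 1, roundUpdate c Sol.run (true, V) (wordsOf K c.k₀ b.toList))) ⁻¹' (goodSetSharp c γ)ᶜ ⊆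
          (fun b : List.Vector Bool (K * c.k₀) => roundUpdate c Sol.run (true, V) (wordsOf K c.k₀ b.toList)) ⁻¹'
            {st | st = (false, V)} := by
        intro b hb
        simp only [Set.mem_preimage, Set.mem_compl_iff, Set.mem_setOf_eq] at hb ⊢
        rcases roundUpdate_running hc Sol.run hV (wordsOf K c.k₀ b.toList) with ⟨V', h1, hV', -, -, hpot'⟩ | ⟨h2, -⟩
        · exfalso
          apply hb
          rw [h1]
          refine ⟨hV', Or.inl ⟨rfl, ?_⟩⟩
          calc potential c.n V' ≤ 7 / 8 * potential c.n V := hpot'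
            _ ≤ 7 / 8 * ((7 / 8 : ℝ) ^ j * potential c.n c.U) := by gcongr
            _ = (7 / 8 : ℝ) ^ (j + 1) * potential c.n c.U := by ring
        · exact h2
      have hmono := measure_mono (μ := (uniformOfFintype (List.Vector Bool (K * c.k₀))).toOuterMeasure) hsub
      refine le_trans (ENNReal.toReal_mono (toOuterMeasure_ne_top' _ _) hmono) ?_
      have h := toReal_roundKernel_stop_le c Sol K hc hV (hK V hV)
      rw [roundKernel, PMF.toOuterMeasure_map_apply] at h
      refine h.trans ?_
      have hq := hsol V hV hprom
      have hq1 : Sol.pr id (roundInst c V).encode (roundInst c V).goodAnswers ≤ 1 :=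
        PMF.toReal_toOuterMeasure_le_one _ _
      exact pow_le_pow_left₀ (by linarith) (by linarith) _
    · -- no promise: every outcome is good (sharp stopping lemma)
      have hsub : (fun b : List.Vector Bool (K * c.k₀) =>
            (j + 1, roundUpdate c Sol.run (true, V) (wordsOf K c.k₀ b.toList))) ⁻¹' (goodSetSharp c γ)ᶜ ⊆ ∅ := by
        intro b hb
        simp only [Set.mem_preimage, Set.mem_compl_iff] at hb
        apply hb
        rcases roundUpdate_running hc Sol.run hV (wordsOf K c.k₀ b.toList) with ⟨V', h1, hV', -, -, hpot'⟩ | ⟨h2, -⟩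
        · rw [h1]
          refine ⟨hV', Or.inl ⟨rfl, ?_⟩⟩
          calc potential c.n V' ≤ 7 / 8 * potential c.n V := hpot'
            _ ≤ 7 / 8 * ((7 / 8 : ℝ) ^ j * potential c.n c.U) := by gcongr
            _ = (7 / 8 : ℝ) ^ (j + 1) * potential c.n c.U := by ring
        · rw [h2]
          exact ⟨hV, Or.inr ⟨rfl, maxNorm_le_of_not_promise_sharp hc hV hprom⟩⟩
      have hmono := measure_mono (μ := (uniformOfFintype (List.Vector Bool (K * c.k₀))).toOuterMeasure) hsub
      rw [measure_empty, nonpos_iff_eq_zero] at hmono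
      change ((uniformOfFintype (List.Vector Bool (K * c.k₀))).toOuterMeasure
        ((fun b : List.Vector Bool (K * c.k₀) =>
          (j + 1, roundUpdate c Sol.run (true, V) (wordsOf K c.k₀ b.toList))) ⁻¹' (goodSetSharp c γ)ᶜ)).toReal ≤ _
      rw [hmono, ENNReal.toReal_zero]
      exact pow_nonneg (by linarith) _
  · -- stopped: deterministic, stays good
    have hsub : (fun b : List.Vector Bool (K * c.k₀) =>
          (j + 1, roundUpdate c Sol.run (false, V) (wordsOf K c.k₀ b.toList))) ⁻¹' (goodSetSharp c γ)ᶜ ⊆ ∅ := by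
      intro b hb
      simp only [Set.mem_preimage, Set.mem_compl_iff, roundUpdate_stopped] at hb
      exact hb ⟨hV, Or.inr ⟨rfl, hshort⟩⟩
    have hmono := measure_mono (μ := (uniformOfFintype (List.Vector Bool (K * c.k₀))).toOuterMeasure) hsub
    rw [measure_empty, nonpos_iff_eq_zero] at hmono
    change ((uniformOfFintype (List.Vector Bool (K * c.k₀))).toOuterMeasure
      ((fun b : List.Vector Bool (K * c.k₀) =>
        (j + 1, roundUpdate c Sol.run (false, V) (wordsOf K c.k₀ b.toList))) ⁻¹' (goodSetSharp c γ)ᶜ)).toReal ≤ _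
    rw [hmono, ENNReal.toReal_zero]
    exact pow_nonneg (by linarith) _

/-- **The law of the loop with the sharp quality** (MR07 Lemma 5.10 run with a probabilistic `IncGDD`
solver, Cor. 5.13): if the solver's coin budget is `K` on every instance met from a good state and it
answers well with probability `≥ p` whenever such an instance satisfies the `IncGDD^{η}_{γ}` promise, then
after `T` rounds with `(7/8)^T · ∏‖uⱼ‖ < 1` the run has STOPPED with good rows of norm `≤ 8 γ η_{2⁻ⁿ}(Λ) + 1`,
except with probability `≤ T (1 − p)^{k₀}` over the uniform coins.
[cite: MicciancioRegev2007, Lemma 5.10 (proof, p. 24: "‖S‖ ≤ 8γφ(B)") and Cor. 5.13 (p. 25)] -/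
theorem toReal_loopOut_bad_le_sharp (hc : c.WF) {T C : ℕ} (hC : K * c.k₀ * T ≤ C) {γ p : ℝ} (hp1 : p ≤ 1)
    (hK : ∀ V, GoodRows c V → Sol.coinLen (roundInst c V).encode.length = K)
    (hsol : ∀ V, GoodRows c V → (roundInst c V).Promise γ →
      p ≤ Sol.pr id (roundInst c V).encode (roundInst c V).goodAnswers)
    (hT : (7 / 8 : ℝ) ^ T * potential c.n c.U < 1) :
    ((uniformOfFintype (List.Vector Bool C)).toOuterMeasure
      {r | ¬ ((loopOut c Sol.run K T r.toList).1 = false ∧ GoodRows c (loopOut c Sol.run K T r.toList).2 ∧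
        Real.sqrt (roundA (loopOut c Sol.run K T r.toList).2) ≤
          8 * (γ * smoothingParameter c.lattice ((2⁻¹ : ℝ) ^ c.n)) + 1)}).toReal ≤ T * (1 - p) ^ c.k₀ := by
  classical
  have hsub : {r : List.Vector Bool C | ¬ ((loopOut c Sol.run K T r.toList).1 = false ∧
        GoodRows c (loopOut c Sol.run K T r.toList).2 ∧
        Real.sqrt (roundA (loopOut c Sol.run K T r.toList).2) ≤
          8 * (γ * smoothingParameter c.lattice ((2⁻¹ : ℝ) ^ c.n)) + 1)} ⊆
      (fun r : List.Vector Bool C => (T, loopOut c Sol.run K T r.toList)) ⁻¹' (goodSetSharp c γ)ᶜ := by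
    intro r hr
    simp only [Set.mem_setOf_eq, Set.mem_preimage, Set.mem_compl_iff] at hr ⊢
    intro hg
    apply hr
    obtain ⟨hV, hcase⟩ := hg
    rcases hcase with ⟨hrun, hpot⟩ | ⟨hstop, hshort⟩
    · exfalso
      have h1 := one_le_potential hV
      dsimp only at hpot h1
      linarith
    · exact ⟨hstop, hV, hshort⟩
  have hmono := measure_mono (μ := (uniformOfFintype (List.Vector Bool C)).toOuterMeasure) hsub
  refine le_trans (ENNReal.toReal_mono (toOuterMeasure_ne_top' _ _) hmono) ?_
  rw [← PMF.toOuterMeasure_map_apply, map_count_loopOut_eq_iterate c Sol K T hC]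
  have h0 : ((0 : ℕ), (true, c.U)) ∈ goodSetSharp c γ :=
    ⟨goodRows_start hc, Or.inl ⟨rfl, by simp⟩⟩
  exact PMF.toReal_toOuterMeasure_iterate_compl_pure_le (roundKernel' c Sol K) (goodSetSharp c γ)
    (η := (1 - p) ^ c.k₀) (pow_nonneg (by linarith) _)
    (toReal_roundKernel'_compl_goodSetSharp_le c Sol K hc hp1 hK hsol) T h0

end MRLemma510

end Literature.Algebra.EuclideanLattices

end
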